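import Summits.CriticalPhenomena.PercolationContinuityZ3.Theorems.PercNearOneGluingNoHeavyLowerTailMajorityGluingQCert3SliceLin
import HarnessLib

/-!
# Slice evaluator soundness, part 2: the partition identity for product terms (lane prim-rate, constants-miner 1, gen 34; NEXT-g35 item 0)

Support file for the closed crux `NoHeavyLowerTail` (stmt-CriticalPhenomena-4575), majority-gluing line; companion of `…QCert3Slice` / `…QCert3SliceLin`.
**`sum_prodSlice`**: for `t < N`, summing `evalC val (prodSlice N i₀ P₁ P₂ t g)` over the smallest index `i₀ < N` gives the full double sum
`evalC val (((suppOf N P₁).map fun p => (suppOf N P₂).map fun q => (key3 N p q t, g p q)).flatten)` — by the telescoping identity `sum_sq_telescope`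
(peel the row and the column of the smallest index off the square `[s, N)²`).  No sorries.
-/

namespace Summit.CriticalPhenomena.PercolationContinuityZ3.Theorems

namespace HubOnly
namespace QCert

noncomputable section

/-- Peeling the smallest index off a square sum: `Σ_{[s,N)²} H = Σ_{q ≥ s} H s q + Σ_{p > s} H p s + Σ_{[s+1,N)²} H`. -/
theorem sum_sq_step (H : ℕ → ℕ → ℝ) (N s : ℕ) (hs : s < N) :
    ∑ p ∈ Finset.Ico s N, ∑ q ∈ Finset.Ico s N, H p q =
      (∑ q ∈ Finset.Ico s N, H s q + ∑ p ∈ Finset.Ico (s + 1) N, H p s) +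
        ∑ p ∈ Finset.Ico (s + 1) N, ∑ q ∈ Finset.Ico (s + 1) N, H p q := by
  rw [Finset.sum_eq_sum_Ico_succ_bot hs]
  have h2 : ∑ p ∈ Finset.Ico (s + 1) N, ∑ q ∈ Finset.Ico s N, H p q =
      ∑ p ∈ Finset.Ico (s + 1) N, (H p s + ∑ q ∈ Finset.Ico (s + 1) N, H p q) :=
    Finset.sum_congr rfl fun p _ => by rw [Finset.sum_eq_sum_Ico_succ_bot hs]
  rw [h2, Finset.sum_add_distrib]
  ring

/-- **Telescoping over the smallest index:** `Σ_{[0,N)²} H = Σ_{i₀ < t} (row + column of i₀) + Σ_{[t,N)²} H`. -/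
theorem sum_sq_telescope (H : ℕ → ℕ → ℝ) (N : ℕ) : ∀ t : ℕ, t ≤ N →
    ∑ p ∈ Finset.Ico 0 N, ∑ q ∈ Finset.Ico 0 N, H p q =
      ∑ i₀ ∈ Finset.Ico 0 t, (∑ q ∈ Finset.Ico i₀ N, H i₀ q + ∑ p ∈ Finset.Ico (i₀ + 1) N, H p i₀) +
        ∑ p ∈ Finset.Ico t N, ∑ q ∈ Finset.Ico t N, H p q
  | 0, _ => by simp
  | t + 1, ht => by
    rw [sum_sq_telescope H N t (by omega), Finset.sum_Ico_succ_top (Nat.zero_le t), sum_sq_step H N t (by omega)]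
    ring

/-- The value of a product slice, by cases on the position of `i₀` relative to `t`. -/
theorem evalC_prodSlice (N i₀ : ℕ) (P₁ P₂ : ℕ → Bool) (t : ℕ) (g : ℕ → ℕ → ℤ) (val : ℕ → ℝ) :
    evalC val (prodSlice N i₀ P₁ P₂ t g) =
      if t < i₀ then 0
      else if t = i₀ then
        ∑ p ∈ Finset.Ico i₀ N, (if P₁ p then ∑ q ∈ Finset.Ico i₀ N, (if P₂ q then (g p q : ℝ) * val (key3 N p q t) else 0) else 0)
      else
        (if P₁ i₀ then ∑ q ∈ Finset.Ico i₀ N, (if P₂ q then (g i₀ q : ℝ) * val (key3 N i₀ q t) else 0) else 0) +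
        (if P₂ i₀ then ∑ p ∈ Finset.Ico (i₀ + 1) N, (if P₁ p then (g p i₀ : ℝ) * val (key3 N p i₀ t) else 0) else 0) := by
  unfold prodSlice
  by_cases h1 : t < i₀
  · rw [if_pos h1, if_pos h1]; simp [evalC]
  · rw [if_neg h1, if_neg h1]
    by_cases h2 : t = i₀
    · rw [if_pos h2, if_pos h2, evalC_flatten, List.map_map, sum_suppGe]
      refine Finset.sum_congr rfl fun p _ => ?_
      by_cases hp : P₁ p = true
      · rw [if_pos hp, if_pos hp, Function.comp_apply, evalC_map, sum_suppGe]
      · rw [if_neg hp, if_neg hp]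
    · rw [if_neg h2, if_neg h2, evalC_append]
      congr 1
      · by_cases hp : P₁ i₀ = true
        · rw [if_pos hp, if_pos hp, evalC_map, sum_suppGe]
        · rw [if_neg hp, if_neg hp]; simp [evalC]
      · by_cases hp : P₂ i₀ = true
        · rw [if_pos hp, if_pos hp, evalC_map, sum_suppGe]
        · rw [if_neg hp, if_neg hp]; simp [evalC]

/-- **Partition identity for product terms:** summing the slices over the smallest index recovers the full double sum (for `t < N`). -/
theorem sum_prodSlice (N : ℕ) (P₁ P₂ : ℕ → Bool) (t : ℕ) (g : ℕ → ℕ → ℤ) (ht : t < N) (val : ℕ → ℝ) :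
    ∑ i₀ ∈ Finset.range N, evalC val (prodSlice N i₀ P₁ P₂ t g) =
      evalC val (((suppOf N P₁).map fun p => (suppOf N P₂).map fun q => (key3 N p q t, g p q)).flatten) := by
  set H : ℕ → ℕ → ℝ := fun p q => if P₁ p then (if P₂ q then (g p q : ℝ) * val (key3 N p q t) else 0) else 0 with hH
  -- the right-hand side is the full square sum of `H`
  have hR : evalC val (((suppOf N P₁).map fun p => (suppOf N P₂).map fun q => (key3 N p q t, g p q)).flatten) =
      ∑ p ∈ Finset.Ico 0 N, ∑ q ∈ Finset.Ico 0 N, H p q := by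
    rw [evalC_flatten, List.map_map, sum_suppOf, ← Finset.range_eq_Ico]
    refine Finset.sum_congr rfl fun p _ => ?_
    by_cases hp : P₁ p = true
    · rw [if_pos hp, Function.comp_apply, evalC_map, sum_suppOf]
      refine Finset.sum_congr rfl fun q _ => ?_
      simp only [hH, hp, if_true]
    · rw [if_neg hp]
      refine (Finset.sum_eq_zero fun q _ => ?_).symm
      simp only [hH, hp]; simp
  rw [hR, sum_sq_telescope H N t ht.le]
  -- the left-hand side termwise
  have hL : ∀ i₀, evalC val (prodSlice N i₀ P₁ P₂ t g) =
      if t < i₀ then 0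
      else if t = i₀ then ∑ p ∈ Finset.Ico i₀ N, ∑ q ∈ Finset.Ico i₀ N, H p q
      else ∑ q ∈ Finset.Ico i₀ N, H i₀ q + ∑ p ∈ Finset.Ico (i₀ + 1) N, H p i₀ := by
    intro i₀
    rw [evalC_prodSlice]
    by_cases h1 : t < i₀
    · rw [if_pos h1, if_pos h1]
    · rw [if_neg h1, if_neg h1]
      by_cases h2 : t = i₀
      · rw [if_pos h2, if_pos h2]
        refine Finset.sum_congr rfl fun p _ => ?_
        by_cases hp : P₁ p = true
        · rw [if_pos hp]; refine Finset.sum_congr rfl fun q _ => ?_; simp only [hH, hp, if_true]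
        · rw [if_neg hp]; refine (Finset.sum_eq_zero fun q _ => ?_).symm; simp only [hH, hp]; simp
      · rw [if_neg h2, if_neg h2]
        congr 1
        · by_cases hp : P₁ i₀ = true
          · rw [if_pos hp]; refine Finset.sum_congr rfl fun q _ => ?_; simp only [hH, hp, if_true]
          · rw [if_neg hp]; refine (Finset.sum_eq_zero fun q _ => ?_).symm; simp only [hH, hp]; simp
        · by_cases hp : P₂ i₀ = true
          · rw [if_pos hp]; refine Finset.sum_congr rfl fun p _ => ?_
            by_cases hq : P₁ p = true
            · simp only [hH, hp, hq, if_true]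
            · simp only [hH, hp, hq]; simp
          · rw [if_neg hp]; refine (Finset.sum_eq_zero fun p _ => ?_).symm
            by_cases hq : P₁ p = true
            · simp only [hH, hp, hq]; simp
            · simp only [hH, hq]; simp
  simp_rw [hL]
  rw [Finset.range_eq_Ico, ← Finset.sum_Ico_consecutive _ (Nat.zero_le t) ht.le, Finset.sum_eq_sum_Ico_succ_bot ht]
  have hlow : ∑ i₀ ∈ Finset.Ico 0 t, (if t < i₀ then (0 : ℝ) else if t = i₀ then ∑ p ∈ Finset.Ico i₀ N, ∑ q ∈ Finset.Ico i₀ N, H p q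
      else ∑ q ∈ Finset.Ico i₀ N, H i₀ q + ∑ p ∈ Finset.Ico (i₀ + 1) N, H p i₀) =
      ∑ i₀ ∈ Finset.Ico 0 t, (∑ q ∈ Finset.Ico i₀ N, H i₀ q + ∑ p ∈ Finset.Ico (i₀ + 1) N, H p i₀) := by
    refine Finset.sum_congr rfl fun i₀ hi₀ => ?_
    rw [Finset.mem_Ico] at hi₀
    rw [if_neg (by omega), if_neg (by omega)]
  have hmid : (if t < t then (0 : ℝ) else if t = t then ∑ p ∈ Finset.Ico t N, ∑ q ∈ Finset.Ico t N, H p q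
      else ∑ q ∈ Finset.Ico t N, H t q + ∑ p ∈ Finset.Ico (t + 1) N, H p t) = ∑ p ∈ Finset.Ico t N, ∑ q ∈ Finset.Ico t N, H p q := by
    rw [if_neg (lt_irrefl t), if_pos rfl]
  have hhigh : ∑ i₀ ∈ Finset.Ico (t + 1) N, (if t < i₀ then (0 : ℝ) else if t = i₀ then ∑ p ∈ Finset.Ico i₀ N, ∑ q ∈ Finset.Ico i₀ N, H p q
      else ∑ q ∈ Finset.Ico i₀ N, H i₀ q + ∑ p ∈ Finset.Ico (i₀ + 1) N, H p i₀) = 0 := by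
    refine Finset.sum_eq_zero fun i₀ hi₀ => ?_
    rw [Finset.mem_Ico] at hi₀
    rw [if_pos (by omega)]
  rw [hlow, hmid, hhigh, add_zero]

end

end QCert
end HubOnly

end Summit.CriticalPhenomena.PercolationContinuityZ3.Theorems
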